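import Literature.MathematicalPhysics.QuantumFieldTheory.Balaban1983to89.B6Prop26Gluing

/-!
# `Balaban1983to89.B6RandomWalkInputNorm` — T. Bałaban, *Propagators and renormalization transformations for lattice gauge theories. II*,
# Commun. Math. Phys. **96** (1984) 223–250 [Balaban1984PropagatorsII], (2.141) p. 247: *"the series above is convergent in the norms
# appearing in the inequalities (2.136)–(2.140)"* READ FOR THE MIXED NORMS OF (2.138)/(2.139) (sup resp. Hölder norm of the OUTPUT, Hölder
# norm `‖J‖^{ξ′}_ε + |J|` of the INPUT) — the block-majorant calculus of (2.51)–(2.55) with the input class «supp μ ⊂ Δ(y′), |μ| ≤ B» of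
# `B6RandomWalk.HasMajorant` replaced by an ARBITRARY admissible input class, on the SAME carriers (file 1 of 2: the notion, composition, the class)

statement-level skeleton of published theorems with citation tags; proofs where landed; nothing here is a claim about the Yang–Mills mass gap

PDF held: `paper:balaban1984-cmp96-propagators-rt-ii` (journal page = PDF page + 222); p. 247 [PDF 25] re-read by this seat on the ×2 render
`run/shared/lean/pub/pub-balaban/b2b-balaban-ref1/pages/1984-cmp96-propagators-rt-II/1984-cmp96-propagators-rt-II-p025-x2.png` (the text layer of
(2.137)–(2.139) is degraded); p. 232 [PDF 10] ((2.51)–(2.55)) as quoted in `…B6RandomWalk`.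

WHAT IS PRINTED (p. 247).  *"|(∇G∇*J)(x)| ≤ O(1)e^{−δ₃d(y,y′)}(‖J‖^{ξ′}_ε + |J|) (2.138) for 0 < ε < 1, x ∈ Δ(y), supp J ⊂ Δ̃(y′), y′ ∈ Λ_{j′},
ξ′ = L^{−j′}, with the constant O(1) depending on d, L, and ε (O(1) → ∞ if ε → 0); ‖ζ∇G∇*J‖_α ≤ O(1)(Lʲη)^{−α}(‖ζ‖^ξ_α + |ζ|)e^{−δ₃d(y,y′)}
(‖J‖^{ξ′}_{α+ε} + |J|) (2.139) for 0 ≤ α < 1, ε > 0, α + ε < 1, ζ ∈ C₀^∞(Δ̃(y)), supp J ⊂ Δ̃(y′) …; The operator G can be represented as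
G = G₀(I − R)⁻¹ = Σ_{n=0}^∞ G₀Rⁿ = Σ_ω h_{□₀}G_{□₀}h_{□₀}·K_{□₁,□₂}G_{□₂}h_{□₂}·…·K_{□_{2n−1},□_{2n}}G_{□_{2n}}h_{□_{2n}}, (2.141) and the
series above is convergent in the norms appearing in the inequalities (2.136)–(2.140)."*; p. 232 after (2.52): *"this property is preserved under
the composition of operators possessing it … A summation preserves it also"*.

CITATION HEADER (lean-in-tree rule) — WHAT IS REPRODUCED.  Phase-2 file of the `lit-balaban` typed skeleton (HOME `run/shared/lean/pub/lit-balaban/`),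
seat **p27 gen 90** (free-target protocol G.5-34(d), TAKING HOME/STATUS 2026-08-24T15:44Z; the B6 fold owner r03's routing line of
2026-08-24T15:29:43Z records the k-level (2.138) `e4` / (2.139) `h2` slots of the `B6.Prop26Printed` census as UNOWNED and names as the first missing
piece *"a generic majorant calculus for the mixed sup/Hölder-input norm (the (2.138)/(2.139) analogue of `B6RandomWalkL2`)"*); SKELETON rows
**B6.Eq2.138** × **B6.Eq2.139** × B6.Prop2.6 × B6.Eq2.141 (cells only; decls of record untouched).
THE READING.  In the walk (2.141) for `∇G∇*` the Hölder norm of the INPUT `J` enters only through the LAST leg (`h_{□₀}G_{□₀}h_{□₀}∇*` for n = 0,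
`K_{□_{2n−1},□_{2n}}G_{□_{2n}}h_{□_{2n}}∇*` for n ≥ 1: the members (1.112)/(1.113) of [Balaban1984PropagatorsI]); every other leg is a sup letter of
`B6RandomWalk.HasMajorant` (*"|(Tμ)(x)| ≤ K(y,y′)|μ|, x ∈ Δ(y), supp μ ⊂ Δ(y′)"*).  What the tree lacked is the bookkeeping of block majorants whose
INPUT size is not the sup norm.  THIS FILE is that bookkeeping, on the carriers of `…B6RandomWalk` (`blk : X → 𝔅` the block map of p. 231, operators
`Module.End ℝ (X → ℝ)`, kernels `𝔅 → 𝔅 → ℝ`), for an arbitrary input class `adm μ y′ B` ("`μ` is an admissible input localised at `y′` of size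
`≤ B`"):
* §1 **`HasMajorantA blk adm T K`** `:= ∀ y′ μ B, adm μ y′ B → ∀ x, |(Tμ)(x)| ≤ K(y(x), y′)·B`; `B6RandomWalk.HasMajorant` IS the case
  `adm = BlockSupp blk` (`hasMajorantA_blockSupp_iff`, `Iff.rfl`); restriction to a smaller class, monotonicity, *"A summation preserves it also"*
  (`hasMajorantA_add/_sub/_finsetSum/_smul`), transport of the class under a right factor (`hasMajorantA_mul_of_mapsTo`);
* §2 **`hasMajorant_mul_hasMajorantA`** — *"preserved under the composition"*: a sup letter `T₁ ≺ K₁` followed (in the order of application) by an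
  admissible-input letter `T₂ ≺_adm K₂ ≥ 0` gives `T₁T₂ ≺_adm Σ_{y″}K₁(y,y″)K₂(y″,y′)` — insert `Σ_{y″}Δ(y″) = I` between the factors exactly as in
  (2.52); the input-localised form of the left factor (the unfolded `…B6InMajorantTransplant.InMajorant` over a set `S`, with `T₂` output-localised to
  `S`: `inMajorant_mul_hasMajorantA`); the fixed-input form `abs_apply_le_sum_of_profile` (an operator with a block majorant applied to ONE function with
  a block profile — the device of r06's `…B9Thm34HolderInputG` §1 for the B9 twins (3.44)/(3.45), here on the abstract carriers);
* §3 the concrete class **`NormSupp blk R N μ y′ B`** (`μ` vanishes off the blocks of the region `R y′` — print's `Δ̃(y′)` —, `N y′ μ ≤ B`, `0 ≤ B`, for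
  ANY size functional `N`; print's `N y′ J = ‖J‖^{ξ′}_ε + |J|`, the census reading `holder ε J + supNorm J` of r03's `…B6KLevelCensusIndexV1.kGeoG`):
  the reading `abs_apply_le_of_hasMajorantA_normSupp` (`|(TJ)(x)| ≤ K(y(x),y′)·N(y′,J)`), monotonicity in the functional
  (`hasMajorantA_normSupp_mono_norm`: a majorant for the class of `‖·‖_ε + |·|` is one for `‖·‖_{α+ε} + |·|` once `‖J‖_ε ≤ ‖J‖_{α+ε}` — the input of
  (2.139)) and in the region, `hasMajorant_of_hasMajorantA_normSupp` (classes containing the block-supported inputs), and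
  **`hasMajorantA_normSupp_of_hasMajorant`** — a sup letter `T ≺ K` is an admissible-input letter with kernel `Σ_{y″∈R(y′)}K(y,y″)` whenever `N`
  dominates the sup (the `+|J|` legs of (2.138)).
The sequel `…B6RandomWalkInputNormChain` carries the localisation/gluing twins of `…B6Prop26Gluing`, (2.63) with any (2.61)-constant, the
(2.138)/(2.139)-shape step `T = T₀ + S·T₁` through the fixed point of (2.91)/(2.141), and the mirror (left fixed point) route on the admissible side.
Defs with bodies: `HasMajorantA` (§1), `NormSupp` (§3, a `structure … : Prop` like `B6RandomWalk.BlockSupp`).  THEOREMS otherwise; no `def … : Prop`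
fact, no new hypothesis-shaped statement; standard axioms.  Imports `…B6Prop26Gluing` only (long built).

HONEST SCOPE / DIVERGENCES.  (1) Pure finite-dimensional bookkeeping: no operator of the paper appears; the analytic inputs of (2.138)/(2.139) at k
levels — the last legs `h_□G_□h_□∇*`, `K_{□,□′}G_{□′}h_{□′}∇*` on Hölder inputs from the members (1.112)/(1.113) (tree: `…B6Prop25Eq112TwoScaleV1`,
`…B6Prop25Eq113TwoScaleV1`) through a window transplant, the k-level gluing, the census readings `kG.e4`/`kG.h2` — are NOT here (B6-CLOSURE §5 item 21,
natural owners p38/p22); this file is their common carrier-free first brick, NOT those slots.  (2) The Hölder norm itself is not defined here (any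
functional `N`); the class laws each lemma needs (`0 ≤ B`; the support region) are explicit hypotheses.  NOT summit progress.
Unit `lit-balaban-p27` (gen 90), 2026-08-24.
-/

noncomputable section

open scoped BigOperators
open Finset

namespace Literature.MathematicalPhysics.QuantumFieldTheory.Balaban1983to89.B6RandomWalkInputNorm

open B6RandomWalk (BlockSupp HasMajorant blockPiece sum_blockPiece blockSupp_blockPiece)
open B6Prop26Gluing (ind ind_of_mem ind_of_not_mem OutLoc)

variable {g : B6.Geometry} {X : Type}

/-! ## §1  Block majorants with respect to an admissible input class -/

section Defs

/-- **BLOCK MAJORANT FOR AN ADMISSIBLE INPUT CLASS**: `|(Tμ)(x)| ≤ K(y(x), y′)·B` for every input `μ` admitted by `adm μ y′ B` ("localised at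
`y′`, of size `≤ B`") and every output point `x` — the printed shape *"|(Tλ)(x)| ≤ K(y,y′)·(size of λ), x ∈ Δ(y), supp λ ⊂ Δ(y′)"* of (2.51)/(2.64)–(2.66)
with the input size left abstract; (2.138)/(2.139) are of this shape with the size `‖J‖^{ξ′}_ε + |J|` and the support `Δ̃(y′)`.
[cite: Balaban1984PropagatorsII, (2.51) p.232 + (2.138)–(2.139) p.247] -/
def HasMajorantA (blk : X → g.Site) (adm : (X → ℝ) → g.Site → ℝ → Prop) (T : Module.End ℝ (X → ℝ))
    (K : g.Site → g.Site → ℝ) : Prop :=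
  ∀ (y' : g.Site) (μ : X → ℝ) (B : ℝ), adm μ y' B → ∀ x : X, |T μ x| ≤ K (blk x) y' * B

variable (blk : X → g.Site) {adm adm' : (X → ℝ) → g.Site → ℝ → Prop}

/-- `B6RandomWalk.HasMajorant` IS the case of the block-supported sup class `adm = BlockSupp blk` (definitionally).
[cite: Balaban1984PropagatorsII, (2.51) p.232, bookkeeping] -/
theorem hasMajorantA_blockSupp_iff {T : Module.End ℝ (X → ℝ)} {K : g.Site → g.Site → ℝ} :
    HasMajorantA blk (BlockSupp blk) T K ↔ HasMajorant blk T K :=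
  Iff.rfl

/-- A sup majorant is a majorant for every class of block-supported sup-bounded inputs.
[cite: Balaban1984PropagatorsII, (2.51) p.232, bookkeeping] -/
theorem hasMajorantA_of_hasMajorant {T : Module.End ℝ (X → ℝ)} {K : g.Site → g.Site → ℝ} (h : HasMajorant blk T K)
    (himp : ∀ (μ : X → ℝ) (y' : g.Site) (B : ℝ), adm μ y' B → BlockSupp blk μ y' B) : HasMajorantA blk adm T K :=
  fun y' μ B hμ x => h y' μ B (himp μ y' B hμ) x

/-- Restriction to a smaller input class (e.g. `‖J‖_{α+ε} + |J| ≤ B` ⟹ `‖J‖_ε + |J| ≤ B`: the input of (2.139)).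
[cite: Balaban1984PropagatorsII, (2.139) p.247, bookkeeping] -/
theorem hasMajorantA_anti {T : Module.End ℝ (X → ℝ)} {K : g.Site → g.Site → ℝ}
    (himp : ∀ (μ : X → ℝ) (y' : g.Site) (B : ℝ), adm' μ y' B → adm μ y' B) (h : HasMajorantA blk adm T K) :
    HasMajorantA blk adm' T K :=
  fun y' μ B hμ x => h y' μ B (himp μ y' B hμ) x

/-- Monotonicity in the kernel (sizes are nonnegative on the class). [cite: Balaban1984PropagatorsII, (2.51) p.232, bookkeeping] -/
theorem hasMajorantA_mono {T : Module.End ℝ (X → ℝ)} {K K' : g.Site → g.Site → ℝ} (h : HasMajorantA blk adm T K)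
    (hadm : ∀ (μ : X → ℝ) (y' : g.Site) (B : ℝ), adm μ y' B → 0 ≤ B) (hle : ∀ a b, K a b ≤ K' a b) :
    HasMajorantA blk adm T K' :=
  fun y' μ B hμ x => (h y' μ B hμ x).trans (mul_le_mul_of_nonneg_right (hle _ _) (hadm μ y' B hμ))

/-- The zero operator. [cite: Balaban1984PropagatorsII, (2.51) p.232, bookkeeping] -/
theorem hasMajorantA_zero : HasMajorantA blk adm (0 : Module.End ℝ (X → ℝ)) (fun _ _ => 0) := by
  intro y' μ B _ x
  simp

/-- *"A summation preserves it also"* (p. 232): majorants add. [cite: Balaban1984PropagatorsII, (2.52) p.232] -/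
theorem hasMajorantA_add {T₁ T₂ : Module.End ℝ (X → ℝ)} {K₁ K₂ : g.Site → g.Site → ℝ}
    (h₁ : HasMajorantA blk adm T₁ K₁) (h₂ : HasMajorantA blk adm T₂ K₂) :
    HasMajorantA blk adm (T₁ + T₂) (fun a b => K₁ a b + K₂ a b) := by
  intro y' μ B hμ x
  rw [LinearMap.add_apply, Pi.add_apply, add_mul]
  exact (abs_add_le _ _).trans (add_le_add (h₁ y' μ B hμ x) (h₂ y' μ B hμ x))

/-- Negation keeps the majorant. [cite: Balaban1984PropagatorsII, (2.52) p.232, bookkeeping] -/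
theorem hasMajorantA_neg {T : Module.End ℝ (X → ℝ)} {K : g.Site → g.Site → ℝ} (h : HasMajorantA blk adm T K) :
    HasMajorantA blk adm (-T) K := by
  intro y' μ B hμ x
  rw [LinearMap.neg_apply, Pi.neg_apply, abs_neg]
  exact h y' μ B hμ x

/-- Differences (the `I − R` of (2.91)): majorants add. [cite: Balaban1984PropagatorsII, (2.91) p.239 + (2.52) p.232, bookkeeping] -/
theorem hasMajorantA_sub {T₁ T₂ : Module.End ℝ (X → ℝ)} {K₁ K₂ : g.Site → g.Site → ℝ}
    (h₁ : HasMajorantA blk adm T₁ K₁) (h₂ : HasMajorantA blk adm T₂ K₂) :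
    HasMajorantA blk adm (T₁ - T₂) (fun a b => K₁ a b + K₂ a b) := by
  rw [sub_eq_add_neg]
  exact hasMajorantA_add blk h₁ (hasMajorantA_neg blk h₂)

/-- Scaling (the factors `ξ = L^{−j}`, `O(M⁻¹)` of (2.134)/(2.137)). [cite: Balaban1984PropagatorsII, (2.94) p.239, bookkeeping] -/
theorem hasMajorantA_smul {T : Module.End ℝ (X → ℝ)} {K : g.Site → g.Site → ℝ} (h : HasMajorantA blk adm T K) (s : ℝ) :
    HasMajorantA blk adm (s • T) (fun a b => |s| * K a b) := by
  intro y' μ B hμ x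
  rw [LinearMap.smul_apply, Pi.smul_apply, smul_eq_mul, abs_mul, mul_assoc]
  exact mul_le_mul_of_nonneg_left (h y' μ B hμ x) (abs_nonneg _)

/-- Finite sums of operators over any index set: the majorants add up (*"A summation preserves it also"*).
[cite: Balaban1984PropagatorsII, (2.52) p.232] -/
theorem hasMajorantA_finsetSum {C : Type} (D : Finset C) (T : C → Module.End ℝ (X → ℝ))
    (K : C → g.Site → g.Site → ℝ) (h : ∀ c ∈ D, HasMajorantA blk adm (T c) (K c)) :
    HasMajorantA blk adm (∑ c ∈ D, T c) (fun a b => ∑ c ∈ D, K c a b) := by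
  intro y' μ B hμ x
  beta_reduce
  rw [LinearMap.sum_apply, Finset.sum_apply, Finset.sum_mul]
  exact (Finset.abs_sum_le_sum_abs _ _).trans (Finset.sum_le_sum fun c hc => h c hc y' μ B hμ x)

/-- **Transport of the input class under a right factor**: if `E` maps the class `adm′` (size `B` at `y′`) into the class `adm` (size `κ(y′)·B` at
`y′`), a majorant `K` of `T` for `adm` gives the majorant `K(y,y′)κ(y′)` of `T·E` for `adm′`.
[cite: Balaban1984PropagatorsII, (2.52) p.232, bookkeeping] -/
theorem hasMajorantA_mul_of_mapsTo {T E : Module.End ℝ (X → ℝ)} {K : g.Site → g.Site → ℝ} {κ : g.Site → ℝ}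
    (h : HasMajorantA blk adm T K)
    (hE : ∀ (μ : X → ℝ) (y' : g.Site) (B : ℝ), adm' μ y' B → adm (E μ) y' (κ y' * B)) :
    HasMajorantA blk adm' (T * E) (fun a b => K a b * κ b) := by
  intro y' μ B hμ x
  rw [Module.End.mul_apply]
  have h1 := h y' (E μ) (κ y' * B) (hE μ y' B hμ) x
  simpa [mul_assoc] using h1

end Defs

/-! ## §2  *"preserved under the composition"*: a sup letter after an admissible-input letter ((2.52) p. 232) -/

section Composition

variable (blk : X → g.Site) {adm : (X → ℝ) → g.Site → ℝ → Prop}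

/-- **(2.52) ⇒ (2.55)ₐ FOR THE MIXED NORM**: if `T₁` has the sup majorant `K₁` (`B6RandomWalk.HasMajorant`) and `T₂` has the majorant `K₂ ≥ 0` for
the admissible class `adm` (sizes `≥ 0`), then `T₁T₂` has the 𝔅-convolution `Σ_{y″} K₁(y,y″)K₂(y″,y′)` as majorant for `adm` — insert
`Σ_{y″} Δ(y″) = I` between the factors as in (2.52): `T₂μ` has the block profile `K₂(y″,y′)B` on `Δ(y″)`.  (In the walk (2.141) for (2.138):
`T₁ = ∇G` with (2.136)₂, `T₂ = R∇*` on Hölder inputs.) [cite: Balaban1984PropagatorsII, (2.52)–(2.55) p.232 + (2.141) p.247] -/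
theorem hasMajorant_mul_hasMajorantA {T₁ T₂ : Module.End ℝ (X → ℝ)} {K₁ K₂ : g.Site → g.Site → ℝ}
    (h₁ : HasMajorant blk T₁ K₁) (h₂ : HasMajorantA blk adm T₂ K₂) (hK₂ : ∀ a b, 0 ≤ K₂ a b)
    (hadm : ∀ (μ : X → ℝ) (y' : g.Site) (B : ℝ), adm μ y' B → 0 ≤ B) :
    HasMajorantA blk adm (T₁ * T₂) (fun a b => ∑ y'' : g.Site, K₁ a y'' * K₂ y'' b) := by
  intro y' μ B hμ x
  have hB : 0 ≤ B := hadm μ y' B hμ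
  have hν : ∀ x, |T₂ μ x| ≤ K₂ (blk x) y' * B := h₂ y' μ B hμ
  have hpiece : ∀ y'' : g.Site, |T₁ (blockPiece blk y'' (T₂ μ)) x| ≤ K₁ (blk x) y'' * (K₂ y'' y' * B) := fun y'' =>
    h₁ y'' _ _ (blockSupp_blockPiece blk (T₂ μ) y'' (K₂ y'' y' * B) (mul_nonneg (hK₂ _ _) hB)
      (fun x' hx' => by simpa [hx'] using hν x')) x
  rw [Module.End.mul_apply]
  conv_lhs => rw [← sum_blockPiece blk (T₂ μ), map_sum, Finset.sum_apply]
  refine (Finset.abs_sum_le_sum_abs _ _).trans ?_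
  rw [Finset.sum_mul]
  refine Finset.sum_le_sum fun y'' _ => ?_
  simpa [mul_assoc] using hpiece y''

/-- a block-supported function in an output-dead zone of `T₂` contributes nothing. [cite: Balaban1984PropagatorsII, (2.92)–(2.93) p.239, bookkeeping] -/
theorem blockPiece_eq_zero_of_outLoc {T₂ : Module.End ℝ (X → ℝ)} {S : Set g.Site} (hout : OutLoc blk T₂ S) (μ : X → ℝ)
    {y'' : g.Site} (hy'' : y'' ∉ S) : blockPiece blk y'' (T₂ μ) = 0 := by
  classical
  funext x'
  by_cases hx' : blk x' = y''
  · have h0 : T₂ μ x' = 0 := hout μ x' (by rw [hx']; exact hy'')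
    simp [blockPiece, hx', h0]
  · simp [blockPiece, hx']

/-- **The same with the left factor known only for inputs over a set `S`** (the hypothesis `h₁` is `…B6InMajorantTransplant.InMajorant blk T₁ S K₁`
unfolded — inputs over `S`, outputs anywhere) **and the right factor output-localised to `S`** (`B6Prop26Gluing.OutLoc`: the left cut-offs `h_□`, `∇h_□`
of (2.92)–(2.93)): `T₁T₂ ≺_adm Σ_{y″} 1_S(y″)K₁(y,y″)K₂(y″,y′)`. [cite: Balaban1984PropagatorsII, (2.52) p.232 + (2.92)–(2.93) p.239 + (2.133) p.247] -/
theorem inMajorant_mul_hasMajorantA {T₁ T₂ : Module.End ℝ (X → ℝ)} {K₁ K₂ : g.Site → g.Site → ℝ} {S : Set g.Site}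
    (h₁ : ∀ y'' ∈ S, ∀ (ν : X → ℝ) (B : ℝ), BlockSupp blk ν y'' B → ∀ x : X, |T₁ ν x| ≤ K₁ (blk x) y'' * B)
    (hout : OutLoc blk T₂ S) (h₂ : HasMajorantA blk adm T₂ K₂) (hK₂ : ∀ a b, 0 ≤ K₂ a b)
    (hadm : ∀ (μ : X → ℝ) (y' : g.Site) (B : ℝ), adm μ y' B → 0 ≤ B) :
    HasMajorantA blk adm (T₁ * T₂) (fun a b => ∑ y'' : g.Site, ind S y'' * K₁ a y'' * K₂ y'' b) := by
  intro y' μ B hμ x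
  have hB : 0 ≤ B := hadm μ y' B hμ
  have hν : ∀ x, |T₂ μ x| ≤ K₂ (blk x) y' * B := h₂ y' μ B hμ
  rw [Module.End.mul_apply]
  conv_lhs => rw [← sum_blockPiece blk (T₂ μ), map_sum, Finset.sum_apply]
  refine (Finset.abs_sum_le_sum_abs _ _).trans ?_
  rw [Finset.sum_mul]
  refine Finset.sum_le_sum fun y'' _ => ?_
  by_cases hy'' : y'' ∈ S
  · rw [ind_of_mem hy'', one_mul]
    have h1 := h₁ y'' hy'' _ _ (blockSupp_blockPiece blk (T₂ μ) y'' (K₂ y'' y' * B) (mul_nonneg (hK₂ _ _) hB)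
      (fun x' hx' => by simpa [hx'] using hν x')) x
    simpa [mul_assoc] using h1
  · rw [blockPiece_eq_zero_of_outLoc blk hout μ hy'', map_zero, Pi.zero_apply, abs_zero, ind_of_not_mem hy'']
    simp

/-- **Majorant × profile** (the fixed-input form of the composition; (2.52) «insert Σ_{y″}Δ(y″) = I»): if `T ≺ K` (sup class) and ONE function `f` has
the block profile `|f(z)| ≤ P(y″)` for `z ∈ Δ(y″)` (`P ≥ 0`), then `|(Tf)(x)| ≤ Σ_{y″} K(y(x), y″)P(y″)`.  (For the B9 twins (3.44)/(3.45) of (2.138)/(2.139)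
this device is `…B9Thm34HolderInputG.abs_apply_le_sum_of_profile` on the `toB6` carriers; here on the abstract ones.)
[cite: Balaban1984PropagatorsII, (2.51)–(2.52) p.232, bookkeeping] -/
theorem abs_apply_le_sum_of_profile {T : Module.End ℝ (X → ℝ)} {K : g.Site → g.Site → ℝ} (hT : HasMajorant blk T K)
    {f : X → ℝ} {P : g.Site → ℝ} (hP : ∀ y, 0 ≤ P y) (hf : ∀ z, |f z| ≤ P (blk z)) (x : X) :
    |T f x| ≤ ∑ y'' : g.Site, K (blk x) y'' * P y'' := by
  have hpiece : ∀ y'' : g.Site, |T (blockPiece blk y'' f) x| ≤ K (blk x) y'' * P y'' := fun y'' =>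
    hT y'' _ _ (blockSupp_blockPiece blk f y'' (P y'') (hP y'') (fun z hz => by rw [← hz]; exact hf z)) x
  conv_lhs => rw [← sum_blockPiece blk f, map_sum, Finset.sum_apply]
  exact (Finset.abs_sum_le_sum_abs _ _).trans (Finset.sum_le_sum fun y'' _ => hpiece y'')

/-- **Admissible letter × admissible input, then a sup letter**: `|(T₁(T₂μ))(x)| ≤ Σ_{y″}K₁(y(x),y″)K₂(y″,y′)·B` for ONE admissible `μ` — the pointwise
content of `hasMajorant_mul_hasMajorantA`. [cite: Balaban1984PropagatorsII, (2.52) p.232, bookkeeping] -/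
theorem abs_mul_apply_le {T₁ T₂ : Module.End ℝ (X → ℝ)} {K₁ K₂ : g.Site → g.Site → ℝ}
    (h₁ : HasMajorant blk T₁ K₁) (h₂ : HasMajorantA blk adm T₂ K₂) (hK₂ : ∀ a b, 0 ≤ K₂ a b)
    (hadm : ∀ (μ : X → ℝ) (y' : g.Site) (B : ℝ), adm μ y' B → 0 ≤ B)
    {μ : X → ℝ} {y' : g.Site} {B : ℝ} (hμ : adm μ y' B) (x : X) :
    |T₁ (T₂ μ) x| ≤ (∑ y'' : g.Site, K₁ (blk x) y'' * K₂ y'' y') * B := by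
  have h := hasMajorant_mul_hasMajorantA blk h₁ h₂ hK₂ hadm y' μ B hμ x
  rwa [Module.End.mul_apply] at h

end Composition

/-! ## §3  The concrete class: inputs supported over a region of blocks, measured by an arbitrary size functional -/

section NormClass

/-- **THE INPUT CLASS OF (2.138)/(2.139)**: `μ` vanishes off the blocks of the region `R y′` (print: *"supp J ⊂ Δ̃(y′)"*, `Δ̃(y′)` a union of `2^d`
blocks; the census of `…B6KLevelCensusIndexV1` uses the single block `{y′}`), its size `N y′ μ` is at most `B`, and `0 ≤ B` — for ANY size functional
`N` (print: `‖J‖^{ξ′}_ε + |J|`, the scale `ξ′ = L^{−j′}` read from `y′`). [cite: Balaban1984PropagatorsII, (2.138)–(2.139) p.247] -/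
structure NormSupp (blk : X → g.Site) (R : g.Site → Set g.Site) (N : g.Site → (X → ℝ) → ℝ)
    (μ : X → ℝ) (y' : g.Site) (B : ℝ) : Prop where
  /-- the size bound is nonnegative. [cite: Balaban1984PropagatorsII, (2.138) p.247, bookkeeping] -/
  nonneg : 0 ≤ B
  /-- *"‖J‖^{ξ′}_ε + |J|"* `≤ B`: the size functional of the input at `y′` is at most `B`. [cite: Balaban1984PropagatorsII, (2.138) p.247] -/
  bound : N y' μ ≤ B
  /-- *"supp J ⊂ Δ̃(y′)"*: the input vanishes off the blocks of the region of `y′`. [cite: Balaban1984PropagatorsII, (2.138) p.247] -/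
  off : ∀ x, blk x ∉ R y' → μ x = 0

variable (blk : X → g.Site) {R R' : g.Site → Set g.Site} {N N' : g.Site → (X → ℝ) → ℝ}

/-- sizes are nonnegative on the class (the law `hadm` of §§1–2 and of the sequel). [cite: Balaban1984PropagatorsII, (2.138) p.247, bookkeeping] -/
theorem normSupp_nonneg : ∀ (μ : X → ℝ) (y' : g.Site) (B : ℝ), NormSupp blk R N μ y' B → 0 ≤ B :=
  fun _ _ _ h => h.nonneg

/-- the support law (the hypothesis `hsuppA` of `inKill_mul_mulOp`). [cite: Balaban1984PropagatorsII, (2.138) p.247, bookkeeping] -/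
theorem normSupp_supp : ∀ (μ : X → ℝ) (y' : g.Site) (B : ℝ), NormSupp blk R N μ y' B → ∀ x, μ x ≠ 0 → blk x ∈ R y' :=
  fun _ _ _ h x hx => by_contra fun hnot => hx (h.off x hnot)

/-- an input supported over its region is admissible with its own size. [cite: Balaban1984PropagatorsII, (2.138) p.247, bookkeeping] -/
theorem normSupp_self {μ : X → ℝ} {y' : g.Site} (hN : 0 ≤ N y' μ) (hoff : ∀ x, blk x ∉ R y' → μ x = 0) :
    NormSupp blk R N μ y' (N y' μ) :=
  ⟨hN, le_rfl, hoff⟩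

/-- **THE READING OF (2.138)**: a majorant `K` for the class gives `|(TJ)(x)| ≤ K(y(x), y′)·N(y′, J)` for every `J` supported over the region of `y′`
(`N ≥ 0`) — with `K = O(1)e^{−δ₃d}` and `N = ‖·‖^{ξ′}_ε + |·|` the printed display. [cite: Balaban1984PropagatorsII, (2.138) p.247] -/
theorem abs_apply_le_of_hasMajorantA_normSupp {T : Module.End ℝ (X → ℝ)} {K : g.Site → g.Site → ℝ}
    (h : HasMajorantA blk (NormSupp blk R N) T K) {μ : X → ℝ} {y' : g.Site} (hN : 0 ≤ N y' μ)
    (hoff : ∀ x, blk x ∉ R y' → μ x = 0) (x : X) : |T μ x| ≤ K (blk x) y' * N y' μ :=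
  h y' μ _ (normSupp_self blk hN hoff) x

/-- a larger size functional gives a smaller class. [cite: Balaban1984PropagatorsII, (2.139) p.247, bookkeeping] -/
theorem normSupp_anti_norm (hle : ∀ (y : g.Site) (μ : X → ℝ), N y μ ≤ N' y μ) {μ : X → ℝ} {y' : g.Site} {B : ℝ}
    (h : NormSupp blk R N' μ y' B) : NormSupp blk R N μ y' B :=
  ⟨h.nonneg, (hle y' μ).trans h.bound, h.off⟩

/-- **Monotonicity in the size functional**: a majorant for the class of `N` is one for the class of any `N′ ≥ N` (`‖J‖_ε ≤ ‖J‖_{α+ε}` on admissible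
pairs: the last legs of (2.139) read on the class of (2.138)). [cite: Balaban1984PropagatorsII, (2.139) p.247] -/
theorem hasMajorantA_normSupp_mono_norm (hle : ∀ (y : g.Site) (μ : X → ℝ), N y μ ≤ N' y μ) {T : Module.End ℝ (X → ℝ)}
    {K : g.Site → g.Site → ℝ} (h : HasMajorantA blk (NormSupp blk R N) T K) : HasMajorantA blk (NormSupp blk R N') T K :=
  hasMajorantA_anti blk (fun _ _ _ hμ => normSupp_anti_norm blk hle hμ) h

/-- a smaller region gives a smaller class. [cite: Balaban1984PropagatorsII, (2.138) p.247, bookkeeping] -/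
theorem normSupp_mono_region (hRR : ∀ y : g.Site, R' y ⊆ R y) {μ : X → ℝ} {y' : g.Site} {B : ℝ}
    (h : NormSupp blk R' N μ y' B) : NormSupp blk R N μ y' B :=
  ⟨h.nonneg, h.bound, fun x hx => h.off x fun hx' => hx (hRR y' hx')⟩

/-- **Monotonicity in the region**: a majorant for inputs over the regions `R` is one for inputs over smaller regions `R′ ⊆ R` (print's `Δ̃(y′)` ⟹ the
census block `Δ(y′)`). [cite: Balaban1984PropagatorsII, (2.138) p.247, bookkeeping] -/
theorem hasMajorantA_normSupp_anti_region (hRR : ∀ y : g.Site, R' y ⊆ R y) {T : Module.End ℝ (X → ℝ)}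
    {K : g.Site → g.Site → ℝ} (h : HasMajorantA blk (NormSupp blk R N) T K) : HasMajorantA blk (NormSupp blk R' N) T K :=
  hasMajorantA_anti blk (fun _ _ _ hμ => normSupp_mono_region blk hRR hμ) h

/-- block-supported sup-bounded inputs are admissible when the region of `y′` contains `y′` and the size is dominated by the sup bound.
[cite: Balaban1984PropagatorsII, (2.51) p.232 + (2.138) p.247, bookkeeping] -/
theorem normSupp_of_blockSupp {μ : X → ℝ} {y' : g.Site} {B : ℝ} (hy : y' ∈ R y')
    (hN : ∀ (ν : X → ℝ) (B' : ℝ), BlockSupp blk ν y' B' → N y' ν ≤ B') (h : BlockSupp blk μ y' B) :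
    NormSupp blk R N μ y' B :=
  ⟨h.nonneg, hN μ B h, fun x hx => h.off x fun heq => hx (by rw [heq]; exact hy)⟩

/-- **A majorant for the class is a sup majorant** when the class contains the block-supported inputs with their sup bounds (`y′ ∈ R y′`, `N` dominated
by the sup on `Δ(y′)`). [cite: Balaban1984PropagatorsII, (2.51) p.232 + (2.138) p.247, bookkeeping] -/
theorem hasMajorant_of_hasMajorantA_normSupp (hy : ∀ y' : g.Site, y' ∈ R y')
    (hN : ∀ (ν : X → ℝ) (y' : g.Site) (B' : ℝ), BlockSupp blk ν y' B' → N y' ν ≤ B')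
    {T : Module.End ℝ (X → ℝ)} {K : g.Site → g.Site → ℝ} (h : HasMajorantA blk (NormSupp blk R N) T K) : HasMajorant blk T K :=
  fun y' μ B hμ x => h y' μ B (normSupp_of_blockSupp blk (hy y') (fun ν B' hν => hN ν y' B' hν) hμ) x

open Classical in
/-- **A SUP LETTER IS AN ADMISSIBLE-INPUT LETTER** (the `+|J|` legs of (2.138): factors bounded by the sup norm of the input alone): if `T ≺ K` (sup
class) and the size functional dominates the sup (`N y′ μ ≤ B` ⟹ `|μ| ≤ B`), then for inputs over the region `R y′` the operator has the majorant
`Σ_{y″∈R(y′)} K(y, y″)` — decompose `μ = Σ_{y″∈R(y′)} Δ(y″)μ`, each piece block-supported with sup `≤ B`.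
[cite: Balaban1984PropagatorsII, (2.51)–(2.52) p.232 + (2.138) p.247] -/
theorem hasMajorantA_normSupp_of_hasMajorant {T : Module.End ℝ (X → ℝ)} {K : g.Site → g.Site → ℝ} (hT : HasMajorant blk T K)
    (hsup : ∀ (μ : X → ℝ) (y' : g.Site) (B : ℝ), NormSupp blk R N μ y' B → ∀ x, |μ x| ≤ B) :
    HasMajorantA blk (NormSupp blk R N) T (fun a b => ∑ y'' : g.Site, ind (R b) y'' * K a y'') := by
  intro y' μ B hμ x
  have hB : 0 ≤ B := hμ.nonneg
  beta_reduce
  conv_lhs => rw [← sum_blockPiece blk μ, map_sum, Finset.sum_apply]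
  refine (Finset.abs_sum_le_sum_abs _ _).trans ?_
  rw [Finset.sum_mul]
  refine Finset.sum_le_sum fun y'' _ => ?_
  by_cases hy'' : y'' ∈ R y'
  · rw [ind_of_mem hy'', one_mul]
    exact hT y'' _ _ (blockSupp_blockPiece blk μ y'' B hB (fun x' _ => hsup μ y' B hμ x')) x
  · have h0 : blockPiece blk y'' μ = 0 := by
      funext x'
      by_cases hx' : blk x' = y''
      · have hμ0 : μ x' = 0 := hμ.off x' (by rw [hx']; exact hy'')
        simp [blockPiece, hx', hμ0]
      · simp [blockPiece, hx']
    rw [h0, map_zero, Pi.zero_apply, abs_zero, ind_of_not_mem hy'']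
    simp

end NormClass

end Literature.MathematicalPhysics.QuantumFieldTheory.Balaban1983to89.B6RandomWalkInputNorm

end
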